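import Summits.ValiantsHypothesis.ValiantsHypothesis.Theorems.MonotoneRestorationOrbitRestorationQPValueOrbitRestoration
import Summits.ValiantsHypothesis.ValiantsHypothesis.Theorems.MonotoneRestorationQP.Negative.LoadBearing
import HarnessLib

/-!
# The permanent has no quasi-polynomial value-orbit computations (calibration of the value-orbit form)

Route MonotoneRestoration, crux `OrbitRestorationQP` (stmt-ValiantsHypothesis-18293), namespace
`Summit.ValiantsHypothesis.ValiantsHypothesis.Theorems.ValueOrbit`.

* `perPoly_not_valueOrbitQP` — for no constant `c` does every `per_n` admit a value derivation (an ordinary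
  computation of any length) all of whose intermediate values have `Sym(Fin n)`-orbits `≤ 2^((log₂ n + c)^c)`
  (value-orbit symmetrisation `qpOrbit_of_valueDerivation` versus Dawar–Wilsenach Thm 7.1, proved in the tree);
* `valueOrbitQP_false_without_VP` — hence the `VP` hypothesis of the value-orbit form of the crux
  (`orbitRestorationQP_iff_valueOrbitQP`) is load-bearing, exactly as for the crux itself
  (`Negative/OrbitRestorationFalseWithoutVP.lean`).

Everything is proved. [folklore]

## References
* A. Dawar, G. Wilsenach, *Symmetric arithmetic circuits*, ToC 21 (2025), Thm. 7.1. [DawarWilsenach2025]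
-/

noncomputable section

open scoped Classical

-- `Summit.ValiantsHypothesis.ValiantsHypothesis.…` is the tree's single-conjunct layout (Sub = Summit).
set_option linter.dupNamespace false

namespace Summit.ValiantsHypothesis.ValiantsHypothesis.Theorems

namespace ValueOrbit

open Literature.Computability.AlgebraicComplexity Filter

/-- **The permanent has no quasi-polynomial value-orbit computations**: for every `c` there is an `n` at
which EVERY value derivation containing `per_n` has a value of `Sym(Fin n)`-orbit `> 2^((log₂ n + c)^c)`.
[cite: DawarWilsenach2025, Thm. 7.1 (p. 18)] -/
theorem perPoly_not_valueOrbitQP (c : ℕ) :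
    ¬ ∀ n : ℕ, ∃ 𝒟 : ValueDerivation ℂ (Fin n × Fin n), perPoly (Fin n) ℂ ∈ 𝒟.S ∧
      ∀ q ∈ 𝒟.S, (Set.range fun σ : Equiv.Perm (Fin n) => ren σ q).ncard ≤ 2 ^ ((Nat.log 2 n + c) ^ c) := by
  intro h
  have hc : ∀ n : ℕ, ∃ (G : Type) (_ : Fintype G) (C : LabelledArithCircuit ℂ (Fin n × Fin n) Unit G),
      C.IsSymmetric (Equiv.Perm (Fin n)) ∧ C.eval (C.output ()) = perPoly (Fin n) ℂ ∧
        C.orbitSize (Equiv.Perm (Fin n)) ≤ 2 ^ ((Nat.log 2 n + (c + 3)) ^ (c + 3)) := by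
    intro n
    obtain ⟨𝒟, hper, hS⟩ := h n
    exact qpOrbit_of_valueDerivation 𝒟 hper (ren_perPoly n) hS
  choose G inst C hCsymm hCeval hCorb using hc
  obtain ⟨ε, hε, hfreq⟩ := @DawarWilsenach2025_thm71_holds ℂ _ _ G inst C hCsymm hCeval
  obtain ⟨n₀, key⟩ := MonotoneRestorationQP.Negative.polylog_pow_lt_linear (c + 3) hε
  obtain ⟨n, hle, hn⟩ := (hfreq.and_eventually (eventually_ge_atTop n₀)).exists
  have horb : (((C n).orbitSize (Equiv.Perm (Fin n)) : ℕ) : ℝ) ≤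
      (2 : ℝ) ^ (((Nat.log 2 n + (c + 3)) ^ (c + 3) : ℕ) : ℝ) := by
    rw [Real.rpow_natCast]
    exact_mod_cast hCorb n
  have hlt : (2 : ℝ) ^ (((Nat.log 2 n + (c + 3)) ^ (c + 3) : ℕ) : ℝ) < (2 : ℝ) ^ (ε * n) := by
    apply (Real.rpow_lt_rpow_left_iff one_lt_two).2
    have := key n hn
    push_cast at this ⊢
    exact this
  exact absurd (hle.trans horb) (not_le.mpr hlt)

/-- **The value-orbit form of the crux without its `VP` hypothesis is FALSE** — witnessed by the
permanent, which is matrix-symmetric: the `VP` hypothesis of `ValueOrbitQP` is load-bearing.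
[cite: DawarWilsenach2025, Thm. 7.1 (p. 18)] -/
theorem valueOrbitQP_false_without_VP :
    ¬ ∀ f : (n : ℕ) → MvPolynomial (Fin n × Fin n) ℂ,
      (∀ (n : ℕ) (σ τ : Equiv.Perm (Fin n)),
        MvPolynomial.rename (fun p : Fin n × Fin n => (σ p.1, τ p.2)) (f n) = f n) →
      ∃ c : ℕ, ∀ n : ℕ, ∃ 𝒟 : ValueDerivation ℂ (Fin n × Fin n), f n ∈ 𝒟.S ∧
        ∀ q ∈ 𝒟.S, (Set.range fun σ : Equiv.Perm (Fin n) => ren σ q).ncard ≤ 2 ^ ((Nat.log 2 n + c) ^ c) := by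
  intro h
  have hsymm : ∀ (n : ℕ) (σ τ : Equiv.Perm (Fin n)),
      MvPolynomial.rename (fun p : Fin n × Fin n => (σ p.1, τ p.2)) (perPoly (Fin n) ℂ) =
        perPoly (Fin n) ℂ := by
    intro n σ τ
    have h' := congrArg (MvPolynomial.map (Complex.ofRealHom.comp NNReal.toRealHom))
      (MonotoneRestorationQP.Negative.rename_perm_perPoly n σ τ)
    rw [MvPolynomial.map_rename, map_perPoly] at h'
    exact h'
  obtain ⟨c, hc⟩ := h (fun n => perPoly (Fin n) ℂ) hsymm
  exact perPoly_not_valueOrbitQP c hc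

end ValueOrbit

end Summit.ValiantsHypothesis.ValiantsHypothesis.Theorems

end
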